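import Summits.CriticalPhenomena.PercolationContinuityZ3.Theorems.Transplant.KNCells2Scheme
import Summits.CriticalPhenomena.PercolationContinuityZ3.Theorems.Transplant.KNCellsStepsChain
import HarnessLib

/-!
# F8 (generic, LAG-1 ANCHORS), part 7 — Kozma–Nitzan's Step IV ((36)–(37)) after a `Valid₂` history: the `KNCellsStepsDefs`/`KNCellsStepsChain`
# lemmas that depend on validity, restated with the two CORE hypotheses `F = E(E_i)` and `ξ ⊆ F` only (so they serve `Valid` and `Valid₂` alike); everything anchor-parametrised
# (`Wfull`, `Reach`, `Aface`, `Bev`, `Gch`, `badA`, `mem_Aface_of_reach`, `badA_subset_Bev`, …) is reused as is with `(a, a') := (α, β)`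

builds on p205010 (kernel theorem, internal audit signed; external expert review pending) — nothing in this file uses p205010.
Lane `prim-bschramm`, seat `prim-bschramm-p2`; helper file (`--supports stmt-CriticalPhenomena-4575`).  Design F8-DESIGN.md §7.

* `coreF_subset_Fp`, `coreF_subset_edgeSet`, `coreF_subset_wireSet`, `core_ae_cyl`, `core_ae_forall_notMem`, `core_ae_good`,
  **`Wt_eq_pinW_Wfull`**; **`real_Gch_le_core`** ((36), unconditioned), **`real_badA_le_core`** ((36)–(37): `μ(badA) ≤ (1-δ₂)^K + μ(Reachᶜ)`).
[cite: KozmaNitzan2024, §4 pp. 29–31 (Steps II–IV, (36), (37)) — the ℤ^d model] [cite: GrimmettPercolation1999, §7.2]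
-/

noncomputable section

open MeasureTheory ProbabilityTheory
open scoped ENNReal Classical

namespace Summit.CriticalPhenomena.PercolationContinuityZ3.Theorems

namespace Transplant

namespace KNCells

open Literature.Probability.Percolation Literature.Probability.LatticeModels SimpleGraph GadgetSystem ProbeHistory HSiteScheme Contour

variable {V : Type*} [DecidableEq V]

namespace KSchA

section Defs₂

variable {A : Type*} {G : SimpleGraph V} [G.LocallyFinite] {S : KSchA V A} {FD : FaceData V A}

section Setting

variable {h : ProbeHistory V} {e : Site 2 × MDir} (hF : S.F G h = edgesIn G (S.Vx G h)) (hξ : S.ξ G h ⊆ S.F G h) {a a' : A}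
  (ha' : a' ∈ S.Γ.anchSet a (tgt e)) {du : MDir}
  (hdu : du ∈ S.onward G h (tgt e)) (hSt : StepsGeom S.Γ FD)
include hF hξ

omit hξ in
/-- The explored edges are pairs of every level. [folklore] -/
theorem coreF_subset_Fp (j : ℕ) : S.F G h ⊆ S.Fp G h e a a' du j :=
  (S.F_subset_Fj hF e a a' du j).trans (Fj_subset_Fp h e a a' du j)

omit hξ in
/-- The explored edges are edges of `G`. [folklore] -/
theorem coreF_subset_edgeSet : (↑(S.F G h) : Set (Sym2 V)) ⊆ G.edgeSet := by
  intro x hx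
  rw [Finset.mem_coe, hF, mem_edgesIn_iff] at hx
  exact hx.1

omit hξ in
include ha' hSt in
/-- The explored edges lie inside `E_i ∪ E_{w,v} ∪ E_{v,x}`. [folklore] -/
theorem coreF_subset_wireSet : ∀ x ∈ S.F G h, x ∈ wireSet (↑(S.Sx G h e a a' du) : Set V) := fun _ hx =>
  coe_Fp_subset_wireSet hSt h e ha' du (Nat.zero_le _) (Finset.mem_coe.2 (coreF_subset_Fp hF 0 hx))

omit hξ in
include ha' hSt in
/-- Under `μ` the pattern on the explored edges is the recorded one, almost surely (pointwise form). [folklore] -/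
theorem core_ae_cyl : ∀ᵐ ω ∂prodBernoulli (S.Wfull G h e a a' du),
    ∀ x ∈ S.F G h, x ∈ ω ↔ x ∈ S.ξ G h := by
  have : S.Wfull G h e a a' du = pinW (restrW (↑(S.Sx G h e a a' du) : Set V) (KNLevels.lattW G S.p)) ↑(S.F G h) ↑(S.ξ G h) := by
    unfold Wfull
    exact restrW_pinW_comm _ _ (fun x hx => coreF_subset_wireSet hF ha' hSt x (Finset.mem_coe.1 hx))
  rw [this]
  filter_upwards [prodBernoulli_pinW_ae_localCylinder _ (S.F G h).finite_toSet.countable (↑(S.ξ G h) : Set (Sym2 V))] with ω hω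
  intro x hx
  have := hω x (Finset.mem_coe.2 hx)
  rw [Finset.mem_coe] at this
  exact this

omit hξ in
/-- Under `μ` no non-edge of `G` is open, almost surely (set form). [folklore] -/
theorem core_ae_forall_notMem [Countable V] : ∀ᵐ ω ∂prodBernoulli (S.Wfull G h e a a' du), ω ⊆ G.edgeSet := by
  have h1 : ∀ᵐ ω ∂prodBernoulli (S.Wfull G h e a a' du), ∀ x ∈ {x : Sym2 V | x ∉ G.edgeSet}, x ∉ ω := by
    refine prodBernoulli_ae_forall_notMem _ (Set.to_countable _) fun x hx => ?_
    unfold Wfull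
    by_cases hxS : x ∈ wireSet (↑(S.Sx G h e a a' du) : Set V)
    · rw [restrW_apply_of_mem _ hxS, pinW_apply_of_not_mem _ _ (fun hxF => hx (coreF_subset_edgeSet hF hxF))]
      rw [KNLevels.lattW_apply, if_neg hx]
    · exact restrW_apply_of_not_mem _ hxS
  filter_upwards [h1] with ω hω x hx
  by_contra hxE
  exact hω x hxE hx

omit hξ in
include ha' hSt in
/-- Under `μ` the recorded pattern holds on the explored edges and every `lattOnly D` holds, almost surely. [folklore] -/
theorem core_ae_good [Countable V] (D : Finset V) : ∀ᵐ ω ∂prodBernoulli (S.Wfull G h e a a' du),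
    ω ∈ localCylinder (↑(S.F G h) : Set (Sym2 V)) ↑(S.ξ G h) ∩ KNLevels.lattOnly G D := by
  filter_upwards [core_ae_cyl hF ha' hSt (du := du), core_ae_forall_notMem hF (a := a) (a' := a') (du := du)] with ω h1 h2
  refine ⟨fun x hx => ?_, fun x _ hxω => h2 hxω⟩
  rw [Finset.mem_coe]
  exact h1 x (Finset.mem_coe.1 hx)

/-! ## §4 The transfer: pinning `μ` on the pairs of level `j` gives the weighting of (30) -/

include ha' hdu hSt in
/-- **Under `μ` pinned on the pairs inside `E_i ∪ E_{w,v} ∪ H^j` along a lattice pattern `T` extending `ω|_{E_i}`, the weighting is that of (30)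
at level `j` (fixed departure anchor `a'`) for the observation `T`.** [cite: KozmaNitzan2024, §4 p. 30 (Step III: "usual percolation on this
auxiliary graph is identical to conditioned percolation on Ω")] -/
theorem Wt_eq_pinW_Wfull {j : ℕ} (hj : j < S.Γ.K) {T : Finset (Sym2 V)}
    (hTc : (↑T : Set (Sym2 V)) ∈ localCylinder (↑(S.F G h) : Set (Sym2 V)) ↑(S.ξ G h))
    (hTl : (↑T : Set (Sym2 V)) ∈ KNLevels.lattOnly G (S.Vx G h ∪ S.Γ.Ewv a e.1 e.2 ∪ S.Γ.Stub a' (tgt e) du j)) :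
    S.Wt G h e a a' du j (obs ↑T (S.env G h e a)) = pinW (S.Wfull G h e a a' du) ↑(S.Fp G h e a a' du j) ↑T := by
  have hFpS := coe_Fp_subset_wireSet (G := G) hSt h e ha' du hj.le
  symm
  funext x
  unfold Wt Wfull
  by_cases hxP : x ∈ S.Fp G h e a a' du j
  · have hxS : x ∈ wireSet (↑(S.Sx G h e a a' du) : Set V) := hFpS (Finset.mem_coe.2 hxP)
    rw [restrW_apply_of_mem _ hxS]
    by_cases hxj : x ∈ S.Fj G h e a a' du j
    · -- an edge of `G` of level `j`: both sides read the pattern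
      have hiff : x ∈ (↑(S.pat G h e a a' du j (obs ↑T (S.env G h e a))) : Set (Sym2 V)) ↔ x ∈ (↑T : Set (Sym2 V)) := by
        rw [Finset.mem_coe, Finset.mem_coe, pat, Finset.mem_union, Finset.mem_inter, mem_obs_iff, Finset.mem_sdiff,
          Finset.mem_coe]
        by_cases hxF : x ∈ S.F G h
        · have h1 := hTc x (Finset.mem_coe.2 hxF)
          rw [Finset.mem_coe, Finset.mem_coe] at h1
          constructor
          · rintro (h2 | ⟨-, -, h3⟩)
            · exact h1.2 h2
            · exact absurd hxF h3
          · intro h2; exact Or.inl (h1.1 h2)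
        · have hxenv : x ∈ S.env G h e a := S.Fj_sdiff_subset_env h e a ha' hdu hj (Finset.mem_sdiff.2 ⟨hxj, hxF⟩)
          constructor
          · rintro (h2 | ⟨⟨-, h3⟩, -, -⟩)
            · exact absurd (hξ h2) hxF
            · exact h3
          · intro h2; exact Or.inr ⟨⟨hxenv, h2⟩, hxj, hxF⟩
      by_cases hxT : x ∈ (↑T : Set (Sym2 V))
      · rw [pinW_apply_of_mem_of_mem _ (Finset.mem_coe.2 hxP) hxT,
          pinW_apply_of_mem_of_mem _ (Finset.mem_coe.2 hxj) (hiff.2 hxT)]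
      · rw [pinW_apply_of_mem_of_not_mem _ (Finset.mem_coe.2 hxP) hxT,
          pinW_apply_of_mem_of_not_mem _ (Finset.mem_coe.2 hxj) (fun h' => hxT (hiff.1 h'))]
    · -- a non-edge pair of level `j`: closed on both sides
      have hxE : x ∉ G.edgeSet := by
        intro hxE
        apply hxj
        rw [Fj, mem_edgesIn_iff]
        refine ⟨hxE, fun y hy => ?_⟩
        have := (Finset.mem_coe.2 hxP : x ∈ (↑(S.Fp G h e a a' du j) : Set (Sym2 V)))
        rw [Fp, KNLevels.coe_pairsF] at this
        exact Finset.mem_coe.1 (this.1 y hy)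
      have hxT : x ∉ (↑T : Set (Sym2 V)) := fun hxT => hxE (hTl x hxP hxT)
      rw [pinW_apply_of_mem_of_not_mem _ (Finset.mem_coe.2 hxP) hxT, pinW_apply_of_not_mem _ _ (fun h' => hxj (Finset.mem_coe.1 h')),
        KNLevels.lattW_apply, if_neg hxE]
  · have hxj : x ∉ (↑(S.Fj G h e a a' du j) : Set (Sym2 V)) := fun h' => hxP (Fj_subset_Fp h e a a' du j (Finset.mem_coe.1 h'))
    have hxF : x ∉ (↑(S.F G h) : Set (Sym2 V)) := fun h' => hxP (coreF_subset_Fp hF j (Finset.mem_coe.1 h'))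
    rw [pinW_apply_of_not_mem _ _ (fun h' => hxP (Finset.mem_coe.1 h'))]
    by_cases hxS : x ∈ wireSet (↑(S.Sx G h e a a' du) : Set V)
    · rw [restrW_apply_of_mem _ hxS, restrW_apply_of_mem _ hxS, pinW_apply_of_not_mem _ _ hxF, pinW_apply_of_not_mem _ _ hxj]
    · rw [restrW_apply_of_not_mem _ hxS, restrW_apply_of_not_mem _ hxS]

end Setting

end Defs₂

section Chain₂

variable [Countable V]
variable {A : Type*} {G : SimpleGraph V} [G.LocallyFinite] {S : KSchA V A} {FD : FaceData V A}
variable {h : ProbeHistory V} {e : Site 2 × MDir} (hF : S.F G h = edgesIn G (S.Vx G h)) (hξ : S.ξ G h ⊆ S.F G h) {a a' : A}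
  (ha' : a' ∈ S.Γ.anchSet a (tgt e)) {du : MDir}
  (hdu : du ∈ S.onward G h (tgt e)) (hSt : StepsGeom S.Γ FD)
include hF hξ ha' hdu hSt

/-! ## The chain (36) and (37), unconditioned -/

/-- **The chain (36)**: `μ(G_j ∩ [ξ]) ≤ (1 - δ₂)^j` for `j ≤ K` — each step pins `μ` on the pairs of level `j` (`Wt_eq_pinW_Wfull`) and uses `B_j`.
[cite: KozmaNitzan2024, §4 p. 31 ((36))] -/
theorem real_Gch_le_core {δ₂ : ℝ} (hδ₂ : δ₂ ≤ 1) :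
    ∀ j ≤ S.Γ.K, (prodBernoulli (S.Wfull G h e a a' du)).real
        (S.Gch G FD h e a a' du δ₂ j ∩ localCylinder (↑(S.F G h) : Set (Sym2 V)) ↑(S.ξ G h)) ≤ (1 - δ₂) ^ j
  | 0, _ => by rw [pow_zero]; exact measureReal_le_one
  | j + 1, hj => by
    set μ := prodBernoulli (S.Wfull G h e a a' du) with hμ
    set Cyl := localCylinder (↑(S.F G h) : Set (Sym2 V)) (↑(S.ξ G h) : Set (Sym2 V)) with hCyl
    set L := KNLevels.lattOnly G (S.Vx G h ∪ S.Γ.Ewv a e.1 e.2 ∪ S.Γ.Stub a' (tgt e) du j) with hL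
    have hj' : j < S.Γ.K := by omega
    have ih := real_Gch_le_core hδ₂ j hj'.le
    -- the conditioning event of level `j`
    set B := S.Bev G FD h e a a' du j δ₂ ∩ S.Gch G FD h e a a' du δ₂ j ∩ Cyl ∩ L with hB
    have hBdet : DeterminedBy B (↑(S.Fp G h e a a' du j) : Set (Sym2 V)) := by
      refine ((((determinedBy_Bev h e a a' du j δ₂).mono (Finset.coe_subset.2 (Fj_subset_Fp h e a a' du j))).inter
        (determinedBy_Gch h e a a' du δ₂ j)).inter
        ((determinedBy_localCylinder _ _).mono (Finset.coe_subset.2 (coreF_subset_Fp hF j)))).inter ?_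
      exact determinedBy_lattOnly _
    -- one step: `μ(A'_j ∩ B) ≤ (1 - δ₂) μ(B)`
    have hstep : μ.real (S.Aface G FD h e a a' du j ∩ B) ≤ (1 - δ₂) * μ.real B := by
      refine prodBernoulli_real_inter_le_of_pinW_le _ _ (measurableSet_Aface h e a a' du j) hBdet fun T _ hTB => ?_
      obtain ⟨⟨⟨hTB, -⟩, hTc⟩, hTl⟩ := hTB
      have hTB' : (prodBernoulli (S.Wt G h e a a' du j (obs ↑T (S.env G h e a)))).real
          (⋃ b ∈ FD.Face a' (tgt e) du (j + 1), openConn S.Γ.root b) ≤ 1 - δ₂ := hTB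
      rw [← Wt_eq_pinW_Wfull hF hξ ha' hdu hSt hj' hTc hTl]
      refine le_trans (measureReal_mono ?_ (measure_ne_top _ _)) hTB'
      rw [Aface, ← Finset.set_biUnion_coe]
      exact biUnion_openConnIn_subset_biUnion_openConn _ _ _
    have e1 : μ.real (S.Gch G FD h e a a' du δ₂ (j + 1) ∩ Cyl) = μ.real (S.Aface G FD h e a a' du j ∩ B) := by
      refine measureReal_congr ?_
      filter_upwards [core_ae_good hF ha' hSt (a := a) (a' := a') (du := du)
        (S.Vx G h ∪ S.Γ.Ewv a e.1 e.2 ∪ S.Γ.Stub a' (tgt e) du j)] with ω hωL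
      refine propext ⟨?_, ?_⟩
      · rintro ⟨⟨hA, hB', hG⟩, hC⟩; exact ⟨hA, ⟨⟨hB', hG⟩, hC⟩, hωL.2⟩
      · rintro ⟨hA, ⟨⟨hB', hG⟩, hC⟩, -⟩; exact ⟨⟨hA, hB', hG⟩, hC⟩
    rw [e1]
    refine hstep.trans ?_
    rw [pow_succ, mul_comm ((1 - δ₂) ^ j)]
    refine mul_le_mul_of_nonneg_left (le_trans (measureReal_mono ?_ (measure_ne_top _ _)) ih) (by linarith)
    rintro ω ⟨⟨⟨-, hG⟩, hC⟩, -⟩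
    exact ⟨hG, hC⟩

/-- **(36)–(37) at the fixed anchors**: `μ(badA) ≤ (1 - δ₂)^K + μ(Reachᶜ)`, given the face-prefix consequences (I3) and the target lemma at
the faces (I2). [cite: KozmaNitzan2024, §4 p. 31 ((36), (37))] -/
theorem real_badA_le_core {δ₂ : ℝ} (hδ₂ : δ₂ ≤ 1)
    (hP1 : ∀ ω, ω ∈ KNLevels.lattOnly G (S.Vx G h ∪ S.Γ.Ewv a e.1 e.2 ∪ FD.Hfull a' (tgt e) du) →
      ω ∈ S.Reach G FD h e a a' du → ω ∈ S.Aface G FD h e a a' du (S.Γ.K - 1))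
    (hP2 : ∀ ω j, 1 ≤ j → j < S.Γ.K → ω ∈ KNLevels.lattOnly G (S.Vx G h ∪ S.Γ.Ewv a e.1 e.2 ∪ S.Γ.Stub a' (tgt e) du (j + 1)) →
      ω ∈ S.Aface G FD h e a a' du j → ω ∈ S.Aface G FD h e a a' du (j - 1))
    (hface : ∀ j < S.Γ.K, ∀ o : Finset (Sym2 V),
      1 - δ₂ < (prodBernoulli (S.Wt G h e a a' du j o)).real (⋃ b ∈ FD.Face a' (tgt e) du (j + 1), openConn S.Γ.root b) →
        S.cond G h e a a' du j o) :
    (prodBernoulli (S.Wfull G h e a a' du)).real (S.badA G h e a a' du) ≤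
      (1 - δ₂) ^ S.Γ.K + (prodBernoulli (S.Wfull G h e a a' du)).real (S.Reach G FD h e a a' du)ᶜ := by
  set μ := prodBernoulli (S.Wfull G h e a a' du) with hμ
  set Cyl := localCylinder (↑(S.F G h) : Set (Sym2 V)) (↑(S.ξ G h) : Set (Sym2 V)) with hCyl
  set L := KNLevels.lattOnly G (S.Vx G h ∪ S.Γ.Ewv a e.1 e.2 ∪ FD.Hfull a' (tgt e) du) with hL
  have hae : ∀ᵐ ω ∂μ, ω ∈ Cyl ∩ L := core_ae_good hF ha' hSt (du := du) _
  have hnull : μ.real (Cyl ∩ L)ᶜ = 0 := by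
    have : μ (Cyl ∩ L)ᶜ = 0 := mem_ae_iff.1 hae
    exact (measureReal_eq_zero_iff (measure_ne_top _ _)).2 this
  have h1 : μ.real (S.badA G h e a a' du) ≤ μ.real (S.badA G h e a a' du ∩ (Cyl ∩ L)) + μ.real (Cyl ∩ L)ᶜ := by
    refine le_trans (measureReal_mono ?_ (measure_ne_top _ _)) (measureReal_union_le _ _)
    intro ω hω
    by_cases h' : ω ∈ Cyl ∩ L
    · exact Or.inl ⟨hω, h'⟩
    · exact Or.inr h'
  have h2 : S.badA G h e a a' du ∩ (Cyl ∩ L) ⊆ (S.Gch G FD h e a a' du δ₂ S.Γ.K ∩ Cyl) ∪ (S.Reach G FD h e a a' du)ᶜ := by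
    rintro ω ⟨hω, hC, hωL⟩
    by_cases hR : ω ∈ S.Reach G FD h e a a' du
    · exact Or.inl ⟨mem_Gch_of_forall (fun j hj => badA_subset_Bev hface hj hω)
        (fun j hj => mem_Aface_of_reach hSt hP1 hP2 hωL hR hj) _ le_rfl, hC⟩
    · exact Or.inr hR
  calc μ.real (S.badA G h e a a' du) ≤ μ.real (S.badA G h e a a' du ∩ (Cyl ∩ L)) + μ.real (Cyl ∩ L)ᶜ := h1
    _ ≤ μ.real ((S.Gch G FD h e a a' du δ₂ S.Γ.K ∩ Cyl) ∪ (S.Reach G FD h e a a' du)ᶜ) + 0 := by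
        rw [hnull]; exact add_le_add (measureReal_mono h2 (measure_ne_top _ _)) le_rfl
    _ ≤ μ.real (S.Gch G FD h e a a' du δ₂ S.Γ.K ∩ Cyl) + μ.real (S.Reach G FD h e a a' du)ᶜ := by
        rw [add_zero]; exact measureReal_union_le _ _
    _ ≤ (1 - δ₂) ^ S.Γ.K + μ.real (S.Reach G FD h e a a' du)ᶜ :=
        add_le_add (real_Gch_le_core hF hξ ha' hdu hSt hδ₂ _ le_rfl) le_rfl

end Chain₂

end KSchA

end KNCells

end Transplant

end Summit.CriticalPhenomena.PercolationContinuityZ3.Theorems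

end
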